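import Summits.SmoothPoincare4.SmoothPoincare4.Theorems.EntropyRungCompactShrinkerGapScalarIdentities
import Summits.SmoothPoincare4.SmoothPoincare4.Theorems.EntropyRungCompactShrinkerGapSigmaTwo
import Summits.SmoothPoincare4.SmoothPoincare4.Theorems.EntropyRungCompactShrinkerGapVarianceBudgetEinstein
import Literature.Geometry.Riemannian.ChernGaussBonnetFour
import Literature.Geometry.Riemannian.ChangGurskyYangEuler
import Literature.Geometry.Riemannian.ChangGurskyYangRegularity
import Literature.Topology.FourManifolds.HomotopyS4SimplyConnected
import Literature.Topology.FourManifolds.SphereSimplyConnected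
import HarnessLib

/-!
# The Weyl energy of a compact shrinker on a homotopy 4-sphere sits below the two-sided Gursky–LeBrun
proportion by exactly `2(Vol − 32π²)` (structural lemma for crux stmt-SmoothPoincare4-10870, line `cgy-variance-pivot`)

For a closed `M ≃ₕ S⁴` with a gradient shrinker `Ric + Hess f = g/2` (Riemannian `g`, smooth `f`), write
`V = Vol(M,g)`, `D = ∫(R − 2)² dV` (so that `∫R² dV = D + 4V`, as `∫R dV = 2V`). The landed identities of the
line (`stub_shrinkerScalarIdentities`, `stub_sigmaTwo_of_identities`: `∫σ₂(A) = V/6 − D/12`) and the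
Chern–Gauss–Bonnet formula at `χ = 2` give the EXACT bookkeeping

  `∫|W|²_{(0,4)} dV = (D + 4V)/3 − 2(V − 32π²) = (1/3)∫R² dV − 2(V − 32π²)`      (`weylEnergy_eq_third_sub`).

Why this matters (refuter's structural finding, drefute gen 4). `(1/3)∫R² = (1/6 + 1/6)∫R²` is the TWO-SIDED
GURSKY–LEBRUN PROPORTION: for a closed oriented EINSTEIN 4-manifold of positive scalar curvature with `W± ≢ 0`,
Gursky–LeBrun (1999) prove `∫|W±|²_End ≥ ∫R²/24`, i.e. `∫|W±|²_{(0,4)} ≥ (1/6)∫R²`, and on a homotopy sphere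
(`τ = 0`, so `∫|W⁺|² = ∫|W⁻|²`) a non-conformally-flat metric has both halves non-zero; every KÄHLER metric has
`|W⁺|²_End = R²/24` pointwise (equality; e.g. the Koiso–Cao shrinker: `∫|W|² = ∫R²/3 = 87.3π²`, matching the
independent calibrations of Disproof §9 / drefute gen 1). Hence:
* in the Einstein sub-case the identity recovers Gursky's bound `V ≤ 32π²` for non-round Einstein shrinkers on a
  homotopy sphere (Disproof §7, `gursky_bound_lt_threshold`: they miss the density bar by the factor `2.92`);
* under the density hypothesis of the crux (`V > 92.8π²`, `volume_floor_numeric`) the deficit exceeds `121π²`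
  (`weylEnergy_add_lt_third_of_dense`): a dense compact shrinker on a homotopy `S⁴` has Weyl energy MORE THAN
  `121π²` BELOW the two-sided Gursky–LeBrun proportion — a regime containing no Einstein metric (GL), no Kähler
  metric (equality), and no known shrinker other than the round sphere (`W = 0`, deficit `2·64π² = 128π²` exactly);
* consequently ANY Gursky–LeBrun-type gap for compact 4-d shrinkers, `W± ≢ 0 ⇒ ∫|W±|²_{(0,4)} ≥ c∫R²` with
  `c ≥ 1/6` (not in print; Cao–Tran 2016 Thm 4.1 is a conditional topological gap, Cao–Ribeiro–Wondo 2025 Thm 4 a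
  weighted upper bound under pinching), would prove outright that dense shrinkers on homotopy 4-spheres are
  locally conformally flat, hence round (Eminenti–La Nave–Mantegazza / Ni–Wallach / Zhang), hence the transfer target
  `stub_varianceBudget` (with `D = 0`) and the crux; and any such gap with `c ≥ 0.035` already makes
  "non-LCF and dense" incompatible with the budget `D < 2V − 96π²`, i.e. reduces the budget to roundness.
Pure consequences of landed theorems + the CGB fact taken as a hypothesis; no Theses statement is concluded.

References: M. Gursky, C. LeBrun, Ann. Global Anal. Geom. 17 (1999) 315–328; X. Cao, H. Tran, Geom. Topol. 20
(2016) 389–436, Thm. 4.1; X. Cao, E. Ribeiro, H. Wondo, arXiv:2509.20669, Thm. 4.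
-/

noncomputable section

open MeasureTheory Set
open scoped Manifold ContDiff ENNReal Topology ContinuousMap

namespace Summit.SmoothPoincare4.SmoothPoincare4.Theorems.CompactShrinkerGap.Negative

-- the registered namespace repeats a component
set_option linter.dupNamespace false

open Summit.SmoothPoincare4.SmoothPoincare4

/-- **Weyl energy of a compact shrinker on a homotopy 4-sphere, exactly**: given the Chern–Gauss–Bonnet
formula, for a closed `M ≃ₕ S⁴` with Riemannian `g` (Levi-Civita), smooth `f` and `Ric + Hess f = g/2`,
`∫|W|²_{(0,4)} = (D + 4V)/3 − 2(V − 32π²)` with `V = Vol`, `D = ∫(R − 2)² dV` (and `D + 4V = ∫R² dV`).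
From `χ = 2` (`finRelHomology_of_homotopyEquiv_sphere_four`), CGB, and the landed `∫σ₂(A) = V/6 − D/12`.
[cite: ChangGurskyYang2003, (1.1) p. 111] [cite: ChengRibeiroZhou2022, Lemma 1 and p. 5] -/
theorem weylEnergy_eq_third_sub (hCGB : Literature.Geometry.Riemannian.chernGaussBonnet_four)
    (M : Type) [TopologicalSpace M] [T2Space M] [SecondCountableTopology M]
    [ChartedSpace (EuclideanSpace ℝ (Fin 4)) M] [IsManifold (𝓡 4) ∞ M] [CompactSpace M]
    [T3Space M] [MeasurableSpace M] [BorelSpace M]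
    (e : M ≃ₕ Metric.sphere (0 : EuclideanSpace ℝ (Fin 5)) 1)
    (g : Literature.Geometry.Lorentzian.PseudoRiemannianMetric (𝓡 4) ∞ (EuclideanSpace ℝ (Fin 4))
      (TangentSpace (𝓡 4) : M → Type _)) [g.HasLeviCivita] (f : M → ℝ) (hg : g.IsRiemannian)
    (hf : ContMDiff (𝓡 4) 𝓘(ℝ, ℝ) ∞ f)
    (hsol : ∀ (x : M) (X Y : TangentSpace (𝓡 4) x),
      g.ricci x X Y + g.hessian f x X Y = (1 / 2 : ℝ) * g.val x X Y) :
    g.weylEnergy.toReal =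
      (∫ x, (g.scalarCurvature x - 2) ^ 2
          ∂(Literature.Geometry.Lorentzian.riemannianMeasure (g.toContMDiffRiemannianMetric hg)) +
        4 * ((Literature.Geometry.Lorentzian.riemannianMeasure (g.toContMDiffRiemannianMetric hg))
              Set.univ).toReal) / 3 -
      2 * (((Literature.Geometry.Lorentzian.riemannianMeasure (g.toContMDiffRiemannianMetric hg))
              Set.univ).toReal - 32 * Real.pi ^ 2) := by
  have hχ : Literature.AlgebraicTopology.SingularHomology.relEuler ℤ ℤ M ∅ = 2 :=
    (Literature.Topology.FourManifolds.finRelHomology_of_homotopyEquiv_sphere_four e).2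
  obtain ⟨_, hB⟩ := Theorems.stub_shrinkerScalarIdentities M g f hg hf hsol
  have hσ := Theorems.stub_sigmaTwo_of_identities M g f hg hf hsol hB
  have h := hCGB M g hg
  rw [hχ] at h
  push_cast at h
  linarith

/-- **A dense compact shrinker on a homotopy 4-sphere is more than `121π²` below the two-sided
Gursky–LeBrun proportion**: with the crux's normalisation `R + |∇f|² = f` and density
`∫e^{-f} dV > 32π²√π e^{-3/2}`, `∫|W|²_{(0,4)} + 121π² < (D + 4V)/3 = (1/3)∫R² dV`
(`weylEnergy_eq_third_sub` and the volume floor `V > 92.8π²`, `volume_floor_numeric`). For comparison: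
Einstein with `W± ≢ 0` has `∫|W|² ≥ (1/3)∫R²` (Gursky–LeBrun), Kähler with `τ = 0` has equality.
[cite: CaoHamiltonIlmanen2004, §4] [cite: ChangGurskyYang2003, (1.1) p. 111] -/
theorem weylEnergy_add_lt_third_of_dense (hCGB : Literature.Geometry.Riemannian.chernGaussBonnet_four)
    (M : Type) [TopologicalSpace M] [T2Space M] [SecondCountableTopology M]
    [ChartedSpace (EuclideanSpace ℝ (Fin 4)) M] [IsManifold (𝓡 4) ∞ M] [CompactSpace M]
    [T3Space M] [MeasurableSpace M] [BorelSpace M]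
    (e : M ≃ₕ Metric.sphere (0 : EuclideanSpace ℝ (Fin 5)) 1)
    (g : Literature.Geometry.Lorentzian.PseudoRiemannianMetric (𝓡 4) ∞ (EuclideanSpace ℝ (Fin 4))
      (TangentSpace (𝓡 4) : M → Type _)) [g.HasLeviCivita] (f : M → ℝ) (hg : g.IsRiemannian)
    (hf : ContMDiff (𝓡 4) 𝓘(ℝ, ℝ) ∞ f)
    (hsol : ∀ (x : M) (X Y : TangentSpace (𝓡 4) x),
      g.ricci x X Y + g.hessian f x X Y = (1 / 2 : ℝ) * g.val x X Y)
    (hnorm : ∀ x : M, g.scalarCurvature x + g.gradSq f x = f x)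
    (hdens : ENNReal.ofReal (32 * Real.pi ^ 2 * Real.sqrt Real.pi * Real.exp (-(3 : ℝ) / 2)) <
      ∫⁻ x, ENNReal.ofReal (Real.exp (-f x))
        ∂(Literature.Geometry.Lorentzian.riemannianMeasure (g.toContMDiffRiemannianMetric hg))) :
    g.weylEnergy.toReal + 121 * Real.pi ^ 2 <
      (∫ x, (g.scalarCurvature x - 2) ^ 2
          ∂(Literature.Geometry.Lorentzian.riemannianMeasure (g.toContMDiffRiemannianMetric hg)) +
        4 * ((Literature.Geometry.Lorentzian.riemannianMeasure (g.toContMDiffRiemannianMetric hg))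
              Set.univ).toReal) / 3 := by
  have hW := weylEnergy_eq_third_sub hCGB M e g f hg hf hsol
  have hV := Theorems.volume_floor_numeric M g f hg hf hsol hnorm hdens
  nlinarith [hW, hV, Real.pi_pos]

/-- **The arithmetic of the hypothetical Gursky–LeBrun gap for shrinkers** (pure reals; records the two
thresholds quoted in the module docstring). If `W = (D + 4V)/3 − 2(V − 32π²)` (the identity above) then
(i) a two-sided gap `W ≥ 2c(D + 4V)` with `c = 1/6` forces `V ≤ 32π²` (so `Θ ≤ 2/e²`, Disproof §7), and
(ii) for `c ≥ 0.035`, `D ≥ 0` and `V ≥ 93.5π²` the same gap forces `D ≥ 2V − 96π²`, i.e. the NEGATION of the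
variance budget — under any such gap the budget can only hold for conformally flat (round) data. [folklore] -/
theorem gurskyLeBrunGap_arith (W D V : ℝ) (hW : W = (D + 4 * V) / 3 - 2 * (V - 32 * Real.pi ^ 2)) :
    (W ≥ 2 * (1 / 6) * (D + 4 * V) → V ≤ 32 * Real.pi ^ 2) ∧
    (∀ c : ℝ, 0.035 ≤ c → 0 ≤ D → 93.5 * Real.pi ^ 2 ≤ V → W ≥ 2 * c * (D + 4 * V) →
      2 * V - 96 * Real.pi ^ 2 ≤ D) := by
  refine ⟨fun h ↦ by linarith, fun c hc hD hV h ↦ ?_⟩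
  have hπ : 0 < Real.pi ^ 2 := by positivity
  -- from the gap and the identity: `(1/3 − 2c)·D ≥ (8c + 2/3)V − 64π²`, and `c ≥ 0.035`, `V ≥ 93.5π²`
  have hDV : (0 : ℝ) ≤ D + 4 * V := by nlinarith [hD, hV, hπ]
  nlinarith [mul_le_mul_of_nonneg_left hc hDV, hc, hD, hV, hπ]

end Summit.SmoothPoincare4.SmoothPoincare4.Theorems.CompactShrinkerGap.Negative

end
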